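import Summits.BirchSwinnertonDyer.BirchSwinnertonDyer.Theorems.EisensteinPrimesResidualStrictEqUnramifiedChar
import HarnessLib

/-!
# `H¹_{𝓕_Gr^{S₀}}(K_∞, M) = H¹_{𝓕_nr^{S₀}}(K_∞, M)` when `ker κ ⊓ I_v̄` acts TRIVIALLY on `M` and some element of `ker κ ⊓ D_v̄`,
# central modulo `ker κ ⊓ I_v̄`, acts with `q₀ − 1` invertible — the strict/unramified bridge at `v̄` for a character
# UNRAMIFIED and NON-TRIVIAL at `v̄` (the `δ`-type residual character of a NON-SPLIT multiplicative Eisenstein prime)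
# (cell `bsd-eis`, width seat `bsd-line-x2-p2` gen 8; crux 4 `BSDpOnCellC` stmt-BirchSwinnertonDyer-19034, line b1 v12 UNCHANGED)

WHY. Crux 4's algebraic chain at a non-split `p ‖ N` (g6/g7, this seat: [ALG-imp] + [PWL-θ] mod PUB) is written in CGLS's
STRICT currency (`KellerYin2024.grSelmer` / `GrDualData`), while the cell's [BR] programme (Rubin's main conjecture for the
residual characters: x1's `IwasawaTwoVariable.charMainConj_conclusion_of_rubin`, `X1.…CharMainConjOnTree`) and Keller–Yin's
Thm. 1.2.2 are written for the UNRAMIFIED groups (`unrSelmer` / `DatumDualData`). CGLS bridge the two in the proof of Thm. 1.2.2: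
«by [PW] (since the primes `w ∤ p` in `Σ` are finitely decomposed in `K_∞/K`) and Proposition 1.1.2 (i), the Selmer group
`H¹_{F_Gr}(K, M_θ)` is the same as the one defined by the unramified local conditions» (for `θ|_{G_v̄} ≠ 𝟙`). At `v̄` the two
residual characters of a NON-SPLIT multiplicative prime are `ωχ` (RAMIFIED — x1-p1-w4's `grSelmer_charModule_eq_unrSelmer_of_ramified`,
p642211/p644436, applies: `M^{ker κ ⊓ I_v̄} = 0`) and `χ` (the non-trivial UNRAMIFIED quadratic character — NOT covered in the tree:
there `M^{ker κ ⊓ I_v̄} = M`). This file proves the unramified case by a Sah-type argument on explicit cocycles and packages both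
cases as: `θ|_{D_v̄} ≠ 𝟙` (Teichmüller) ⟹ `grSelmer = unrSelmer`, GRANTED that `D_v̄/I_v̄` is abelian in the form
`hDI : ∀ x y ∈ D_v̄, x⁻¹ y⁻¹ x y ∈ I_v̄` (the Frobenius quotient of a local Galois group is procyclic; kept as an explicit
HYPOTHESIS here, to be discharged from the local Galois library in a sequel — nothing is asserted about it).

WHAT (any number field `K`, any `ℤ_p`-extension `κ`, any place `v`/`v̄`, any discrete `Γ_K`-module `M` unless stated).
* §1 `resOfLe_decomp_eq_zero_of_mem_unramifiedKer_of_central` — for `H ≤ Γ_K`: if `H ⊓ I_v` acts trivially on `M` and some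
  `q₀ ∈ H ⊓ D_v` with `x⁻¹q₀⁻¹xq₀ ∈ I_v` for all `x ∈ H ⊓ D_v` has `m ↦ q₀•m − m` BIJECTIVE on `M`, then a class of `H¹(H, M)`
  unramified at `v` (dies on `H ⊓ I_v`) dies on `H ⊓ D_v`. Proof: for a cocycle `w` vanishing on `H ⊓ I_v` and `x ∈ H ⊓ D_v`,
  `xq₀ = q₀x·n` with `n ∈ H ⊓ I_v` gives `(q₀−1)w(x) = (x−1)w(q₀) = (x−1)(q₀−1)m₀ = (q₀−1)(x−1)m₀` for `w(q₀) = (q₀−1)m₀`, whence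
  `w(x) = (x−1)m₀` (inflation–restriction: `H¹(⟨q̄₀⟩-central quotient, M) = 0`; Sah's lemma).
* §2 `grSelmer_eq_unrSelmer_of_central` — Selmer level over `K_∞` (`H = ker κ`), all `S₀`.
* §3 `grSelmer_charModule_eq_unrSelmer_of_decomp_ne_one` — for `M = (F/𝒪)(θ)`, `θ^{p−1} = 1`, some `τ ∈ D_v̄` with `θ(τ) ≠ 1`,
  and `hDI`: `grSelmer κ (charModule ∅ θ) v̄ S₀ = unrSelmer κ (charModule ∅ θ) v̄ S₀` — case `θ` ramified at `v̄`: x1-p1-w4's theorem;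
  case `θ(I_v̄) = 1`: §2 with `q₀ ∈ ker κ ⊓ D_v̄`, `θ(q₀) ≠ 1` (the `p`-power descent `exists_mem_inf_kerSubgroup_unitChar_ne_one`),
  `θ(q₀) − 1 ∈ ℤ_p^×` (Teichmüller) so `q₀ − 1` is bijective on `(F/𝒪)(θ) ≅ ℚ_p/ℤ_p`; also the residual-hypothesis form
  `…_of_not_forall_decomp` («`D_v̄` does not fix `(F/𝒪)(θ)[p]` pointwise», the binder of CGLS §1.2's named facts).

HONEST FRAMING: Galois-cohomology bookkeeping on constructed objects; no definition, no named fact, no `sorry`, no `Theses` import;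
`hDI` is a HYPOTHESIS of §2–§3 (not discharged here); nothing about any curve is asserted; closes no stub of v12; BSD / Mazur's MC /
IMC proved for no curve.

References: [CastellaGrossiLeeSkinner2022] §1.1 Prop. 1.1.2 (i), proof of Thm. 1.2.2 (Invent. Math. 227 (2022); arXiv:2008.02571
Thm. 11); [KellerYin2024] Lemma 1.2.4 and Rem. 1.2.3 (arXiv:2402.12781v2 TeX L736–800); [SerreGaloisCohomology1997] I §2.6 (b);
[Greenberg1989] §1 p. 98; [SerreLocalFields1979] IV §2, I §7 Prop. 20; Sah, «Automorphisms of finite groups», J. Algebra 10 (1968)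
(the central-element lemma — folklore form).
-/

set_option autoImplicit false
set_option linter.dupNamespace false -- the summit namespace `…BirchSwinnertonDyer.BirchSwinnertonDyer.Theorems` (Sub = Summit, D-0017) trips it

noncomputable section

open scoped Classical

namespace Summit.BirchSwinnertonDyer.BirchSwinnertonDyer.Theorems.StrictEqUnramifiedCentral

open NumberField IsDedekindDomain Field
open Literature.NumberTheory.EllipticCurves Literature.NumberTheory.EllipticCurves.GreenbergSelmer
  Literature.NumberTheory.EllipticCurves.GreenbergVatsal2000 Literature.NumberTheory.GaloisRepresentations
  Literature.NumberTheory.EllipticCurves.KellerYin2024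
  Summit.BirchSwinnertonDyer.BirchSwinnertonDyer.Theorems.CharResidualSelmerCount
  Summit.BirchSwinnertonDyer.BirchSwinnertonDyer.Theorems.CharResidualSelmerFinite

/-! ### §1 Inflation–restriction with a central element: unramified at `v` ⟹ locally trivial at `v` -/

section Local

variable {K : Type} [Field K] [NumberField K] (H : Subgroup (absoluteGaloisGroup K))
  {M : Type} [AddCommGroup M] [DistribMulAction (absoluteGaloisGroup K) M] [TopologicalSpace M]
  [DiscreteTopology M]

/-- **A class of `H¹(H, M)` unramified at `v` is locally trivial at `v` when `H ⊓ I_v` acts trivially on `M` and a `q₀ ∈ H ⊓ D_v`,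
central modulo `I_v` on `H ⊓ D_v` (only `q₀ ∈ H` and the commutator condition are used), has `q₀ − 1` bijective on `M`.** If `z|_{H⊓I_v} = ∂a`, the corrected cocycle `w = z − ∂a`
vanishes on `H ⊓ I_v`; for `x ∈ H ⊓ D_v` write `x q₀ = q₀ x n` with `n = x⁻¹q₀⁻¹xq₀ ∈ H ⊓ I_v` (so `w(n) = 0`, `n` acts trivially and the
actions of `x`, `q₀` commute): `w(x) + x·w(q₀) = w(q₀) + q₀·w(x)`. With `w(q₀) = q₀·m₀ − m₀` this reads
`(q₀−1)·w(x) = (q₀−1)·(x·m₀ − m₀)`, so `w(x) = x·m₀ − m₀` and `z|_{H⊓D_v} = ∂(a + m₀)`. (Sah's lemma: `H¹` of a group with a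
central element acting invertibly-minus-one vanishes; here only modulo the inertia part.) [cite: SerreGaloisCohomology1997, I.§2.6 (b)]
[cite: CastellaGrossiLeeSkinner2022, §1.1 Prop. 1.1.2 (i) and proof of Thm. 1.2.2 (arXiv:2008.02571 Thm. 11)] -/
theorem resOfLe_decomp_eq_zero_of_mem_unramifiedKer_of_central (v : HeightOneSpectrum (𝓞 K))
    (hIfix : ∀ g : absoluteGaloisGroup K, g ∈ H → g ∈ inertia v → ∀ m : M, g • m = m)
    {q₀ : absoluteGaloisGroup K} (hq₀H : q₀ ∈ H)
    (hcomm : ∀ x : absoluteGaloisGroup K, x ∈ H → x ∈ decomp v → x⁻¹ * q₀⁻¹ * x * q₀ ∈ inertia v)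
    (hbij : Function.Bijective fun m : M ↦ q₀ • m - m)
    {c : subgroupH1 H M} (hc : c ∈ unramifiedKer H M v) :
    resOfLe M (inf_le_left : H ⊓ decomp v ≤ H) c = 0 := by
  obtain ⟨z, rfl⟩ := oneCocycleClass_surjective _ c
  rw [GreenbergVatsal2000.unramifiedKer, AddMonoidHom.mem_ker,
    CocycleCriteria.resH1Hom_oneCocycleClass_eq_zero_iff] at hc
  obtain ⟨a, ha⟩ := hc
  rw [CocycleCriteria.resOfLe_oneCocycleClass_eq_zero_iff]
  -- the corrected function `w g = z g - (g • a - a)` on `H`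
  let w : H → M := fun g ↦ z.1 g - ((g : absoluteGaloisGroup K) • a - a)
  have hwmul : ∀ g h : H, w (g * h) = w g + (g : absoluteGaloisGroup K) • w h := by
    intro g h
    have hz : z.1 (g * h) = z.1 g + (g : absoluteGaloisGroup K) • z.1 h := z.2 g h
    simp only [w, hz, Subgroup.coe_mul, mul_smul, smul_sub]
    abel
  -- `w` vanishes on `H ⊓ I_v`
  have hwI : ∀ g : H, (g : absoluteGaloisGroup K) ∈ inertia v → w g = 0 := by
    intro g hg
    have hgD : (g : absoluteGaloisGroup K) ∈ decomp v := inertia_le_decomp v hg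
    have key := ha ⟨⟨(g : absoluteGaloisGroup K), hgD⟩, (mem_inertiaIn_iff H v _).2 ⟨g.2, hg⟩⟩
    change z.1 (inertiaInToH H v _) = (g : absoluteGaloisGroup K) • a - a at key
    have e : inertiaInToH H v ⟨⟨(g : absoluteGaloisGroup K), hgD⟩,
        (mem_inertiaIn_iff H v _).2 ⟨g.2, hg⟩⟩ = g := Subtype.ext rfl
    rw [e] at key
    simp only [w, key, sub_self]
  -- `m₀` with `q₀ • m₀ - m₀ = w q₀`
  let qH : H := ⟨q₀, hq₀H⟩
  obtain ⟨m₀, hm₀⟩ := hbij.2 (w qH)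
  refine ⟨a + m₀, fun x ↦ ?_⟩
  let xH : H := ⟨(x : absoluteGaloisGroup K), (Subgroup.mem_inf.mp x.2).1⟩
  have hxD : (x : absoluteGaloisGroup K) ∈ decomp v := (Subgroup.mem_inf.mp x.2).2
  -- the commutator `n = x⁻¹ q₀⁻¹ x q₀ ∈ H ⊓ I_v`
  have hnI : (x : absoluteGaloisGroup K)⁻¹ * q₀⁻¹ * x * q₀ ∈ inertia v := hcomm x xH.2 hxD
  have hnH : (x : absoluteGaloisGroup K)⁻¹ * q₀⁻¹ * x * q₀ ∈ H :=
    H.mul_mem (H.mul_mem (H.mul_mem (H.inv_mem xH.2) (H.inv_mem hq₀H)) xH.2) hq₀H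
  let n : H := ⟨(x : absoluteGaloisGroup K)⁻¹ * q₀⁻¹ * x * q₀, hnH⟩
  have hxq : xH * qH = qH * xH * n := Subtype.ext (by
    change (x : absoluteGaloisGroup K) * q₀ = q₀ * x * ((x : absoluteGaloisGroup K)⁻¹ * q₀⁻¹ * x * q₀)
    group)
  have hnfix : ∀ m : M, ((x : absoluteGaloisGroup K)⁻¹ * q₀⁻¹ * x * q₀) • m = m := hIfix _ hnH hnI
  have hwn : w n = 0 := hwI n hnI
  -- the two expansions of `w (x q₀) = w (q₀ x n)`
  have h1 : w (xH * qH) = w xH + (x : absoluteGaloisGroup K) • w qH := hwmul xH qH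
  have h2 : w (qH * xH * n) = w qH + q₀ • w xH := by
    rw [hwmul, hwmul, hwn, smul_zero, add_zero]
  have hkey : q₀ • w xH - w xH = (x : absoluteGaloisGroup K) • w qH - w qH := by
    rw [hxq] at h1
    rw [h1] at h2
    -- h2 : w xH + x • w qH = w qH + q₀ • w xH
    rw [sub_eq_sub_iff_add_eq_add, add_comm (q₀ • w xH), ← h2, add_comm]
  -- the actions of `x` and `q₀` commute on `M`
  have hcommM : ∀ m : M, (x : absoluteGaloisGroup K) • q₀ • m = q₀ • (x : absoluteGaloisGroup K) • m := fun m ↦ by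
    rw [← mul_smul, show (x : absoluteGaloisGroup K) * q₀ = q₀ * x * ((x : absoluteGaloisGroup K)⁻¹ * q₀⁻¹ * x * q₀) by group,
      mul_smul, mul_smul, hnfix]
  have hm₀' : q₀ • m₀ - m₀ = w qH := hm₀
  have hR : (x : absoluteGaloisGroup K) • w qH - w qH =
      q₀ • ((x : absoluteGaloisGroup K) • m₀ - m₀) - ((x : absoluteGaloisGroup K) • m₀ - m₀) := by
    simp only [← hm₀', smul_sub, hcommM]
    abel
  have hwx : w xH = (x : absoluteGaloisGroup K) • m₀ - m₀ := hbij.1 (hkey.trans hR)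
  have e : Subgroup.inclusion (inf_le_left : H ⊓ decomp v ≤ H) x = xH := Subtype.ext rfl
  rw [e]
  have hz : z.1 xH = w xH + ((x : absoluteGaloisGroup K) • a - a) := by
    change z.1 xH = z.1 xH - ((x : absoluteGaloisGroup K) • a - a) + ((x : absoluteGaloisGroup K) • a - a)
    abel
  rw [hz, hwx, smul_add]
  abel

end Local

/-! ### §2 Selmer level: `H¹_{𝓕_Gr^{S₀}}(K_∞, M) = H¹_{𝓕_nr^{S₀}}(K_∞, M)` from a central element of `ker κ ⊓ D_v̄` -/

section Selmer

variable {K : Type} [Field K] [NumberField K] {p : ℕ} [hp : Fact p.Prime] (κ : ZpExtension K p)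
  {M : Type} [AddCommGroup M] [DistribMulAction (absoluteGaloisGroup K) M] [TopologicalSpace M]
  [DiscreteTopology M] (vbar : HeightOneSpectrum (𝓞 K)) (S₀ : Set (HeightOneSpectrum (𝓞 K)))

/-- **`H¹_{𝓕_Gr^{S₀}}(K_∞, M) = H¹_{𝓕_nr^{S₀}}(K_∞, M)` when `ker κ ⊓ I_v̄` acts trivially on `M` and some `q₀ ∈ ker κ ⊓ D_v̄`, central modulo
`I_v̄` on `ker κ ⊓ D_v̄`, has `q₀ − 1` bijective on `M`** (any number field, any `ℤ_p`-extension, any discrete `Γ_K`-module, any `S₀`):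
the two groups differ only above `v̄` (Greenberg's inertia condition for Castella's strict datum `M⁺_v̄ = 0` versus the strict one),
and §1 identifies them conjugate by conjugate (the hypotheses are conjugation-invariant). CGLS: «the Selmer group `H¹_{F_Gr}(K, M_θ)`
is the same as the one defined by the unramified local conditions» (proof of Thm. 1.2.2, via Prop. 1.1.2 (i), for `θ|_{G_v̄} ≠ 𝟙`).
[cite: CastellaGrossiLeeSkinner2022, proof of Thm. 1.2.2 and Prop. 1.1.2 (i) (arXiv:2008.02571 Thm. 11)] [cite: Greenberg1989, §1 p. 98] -/
theorem grSelmer_eq_unrSelmer_of_central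
    (hIfix : ∀ g : absoluteGaloisGroup K, g ∈ κ.kerSubgroup → g ∈ inertia vbar → ∀ m : M, g • m = m)
    {q₀ : absoluteGaloisGroup K} (hq₀H : q₀ ∈ κ.kerSubgroup)
    (hcomm : ∀ x : absoluteGaloisGroup K, x ∈ κ.kerSubgroup → x ∈ decomp vbar → x⁻¹ * q₀⁻¹ * x * q₀ ∈ inertia vbar)
    (hbij : Function.Bijective fun m : M ↦ q₀ • m - m) :
    grSelmer κ M vbar S₀ = unrSelmer κ M vbar S₀ := by
  refine le_antisymm (grSelmer_le_unrSelmer κ M vbar S₀) fun c hc ↦ ?_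
  change c ∈ datumSelmer κ.kerSubgroup M p (Castella2018.AcSelmer.bdpData M p vbar) S₀ at hc
  change c ∈ datumStrictSelmer κ.kerSubgroup M p (Castella2018.AcSelmer.bdpData M p vbar) S₀
  rw [mem_datumSelmer_iff] at hc
  rw [mem_datumStrictSelmer_iff]
  refine ⟨hc.1, fun v hv σ ↦ ?_⟩
  by_cases hv𝔭 : v = vbar
  · subst hv𝔭
    have h' := hc.2 v hv σ
    rw [Castella2018.AcSelmer.bdpData_self p v hv] at h' ⊢
    rw [mem_greenbergKer_strictDatum_iff] at h'
    rw [mem_strictKer_strictDatum_iff_resOfLe]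
    exact resOfLe_decomp_eq_zero_of_mem_unramifiedKer_of_central κ.kerSubgroup v hIfix hq₀H hcomm hbij h'
  · rw [Castella2018.AcSelmer.bdpData_of_ne p vbar hv hv𝔭, Castella2018.AcSelmer.strictKer_relaxedDatum_eq_top]
    exact AddSubgroup.mem_top _

end Selmer

/-! ### §3 The character module `(F/𝒪)(θ)` with `θ|_{D_v̄} ≠ 𝟙` (Teichmüller), granted `[D_v̄, D_v̄] ⊆ I_v̄` -/

section Character

variable {K : Type} [Field K] [NumberField K] {p : ℕ} [hp : Fact p.Prime] (κ : ZpExtension K p)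
  (vbar : HeightOneSpectrum (𝓞 K)) (S₀ : Set (HeightOneSpectrum (𝓞 K)))
  (θ : FramedGaloisRep K (padicCoeffIntegers (∅ : Set (PadicAlgCl p))) 1)

omit [NumberField K] in
/-- An element `g` with `θ(g) = 1` acts trivially on `(F/𝒪)(θ)`. [cite: KellerYin2024, §1.1 (arXiv:2402.12781v2 TeX L441–449)] -/
theorem smul_charModule_eq_of_unitChar_eq_one {g : absoluteGaloisGroup K} (hg : unitChar θ g = 1)
    (m : charModule (∅ : Set (PadicAlgCl p)) θ) : g • m = m := by
  obtain ⟨z, rfl⟩ := (charModuleEquiv θ).symm.surjective m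
  rw [galois_smul_charModuleEquiv_symm, hg, Units.val_one, one_smul]

omit [NumberField K] in
/-- **`m ↦ g•m − m` is BIJECTIVE on `(F/𝒪)(θ)` when `θ(g) ≠ 1`** (`θ^{p−1} = 1`: `θ(g) − 1 ∈ ℤ_p^×`, and `(F/𝒪)(θ) ≅ ℚ_p/ℤ_p` with
`g` acting by `θ(g)`). [cite: SerreLocalFields1979, IV §2 (Teichmüller units)] [cite: KellerYin2024, proof of Lemma 1.2.4 (arXiv:2402.12781v2 TeX L766–772)] -/
theorem bijective_smul_sub_of_unitChar_ne_one (hθ : ∀ σ : absoluteGaloisGroup K, θ σ ^ (p - 1) = 1)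
    {g : absoluteGaloisGroup K} (hg : unitChar θ g ≠ 1) :
    Function.Bijective fun m : charModule (∅ : Set (PadicAlgCl p)) θ ↦ g • m - m := by
  have hupow : ((unitChar θ g : ℤ_[p]ˣ) : ℤ_[p]) ^ (p - 1) = 1 := by
    rw [← Units.val_pow_eq_pow_val, unitChar_pow_eq_one θ hθ, Units.val_one]
  have hu1 : ((unitChar θ g : ℤ_[p]ˣ) : ℤ_[p]) ≠ 1 := fun h1 ↦ hg (Units.ext h1)
  have hunit := isUnit_sub_one_of_pow_sub_one_eq_one_of_ne_one hupow hu1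
  set e := charModuleEquiv θ with he
  -- conjugate to scalar multiplication by the unit `θ(g) − 1` on `ℚ_p/ℤ_p`
  have hconj : ∀ m : charModule (∅ : Set (PadicAlgCl p)) θ,
      g • m - m = e.symm ((((unitChar θ g : ℤ_[p]ˣ) : ℤ_[p]) - 1) • e m) := fun m ↦ by
    conv_lhs => rw [← e.symm_apply_apply m]
    rw [galois_smul_charModuleEquiv_symm, sub_smul, one_smul, map_sub]
  constructor
  · intro m m' h
    have h' : e.symm ((((unitChar θ g : ℤ_[p]ˣ) : ℤ_[p]) - 1) • e m) =
        e.symm ((((unitChar θ g : ℤ_[p]ˣ) : ℤ_[p]) - 1) • e m') := by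
      rw [← hconj, ← hconj]; exact h
    have h'' := e.symm.injective h'
    have h3 : e m = e m' := by
      have key : ((hunit.unit⁻¹ : ℤ_[p]ˣ) : ℤ_[p]) • ((((unitChar θ g : ℤ_[p]ˣ) : ℤ_[p]) - 1) • e m) =
          ((hunit.unit⁻¹ : ℤ_[p]ˣ) : ℤ_[p]) • ((((unitChar θ g : ℤ_[p]ˣ) : ℤ_[p]) - 1) • e m') := by rw [h'']
      rwa [smul_smul, smul_smul, IsUnit.val_inv_mul, one_smul, one_smul] at key
    exact e.injective h3
  · intro b
    refine ⟨e.symm (((hunit.unit⁻¹ : ℤ_[p]ˣ) : ℤ_[p]) • e b), ?_⟩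
    change g • _ - _ = b
    rw [hconj, e.apply_symm_apply, smul_smul, IsUnit.mul_val_inv, one_smul, e.symm_apply_apply]

/-- `D_v̄` is closed in `Γ_K` (image of the compact `Γ_{K_v̄}`). [cite: NeukirchANT1999, Ch. II §9 Prop. (9.6)] -/
theorem isClosed_decomp : IsClosed ((decomp vbar : Subgroup (absoluteGaloisGroup K)) : Set (absoluteGaloisGroup K)) := by
  haveI : CompactSpace (absoluteGaloisGroup (vbar.adicCompletion K)) :=
    absoluteGaloisGroup_compactSpace (vbar.adicCompletion K)
  exact (isCompact_range (absGaloisRestrict K (vbar.adicCompletion K)).continuous_toFun).isClosed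

/-- **`H¹_{𝓕_Gr^{S₀}}(K_∞, (F/𝒪)(θ)) = H¹_{𝓕_nr^{S₀}}(K_∞, (F/𝒪)(θ))` for a Teichmüller character `θ` NON-TRIVIAL on `D_v̄`, granted
`[D_v̄, D_v̄] ⊆ I_v̄`** (`hDI`; any number field, any `ℤ_p`-extension, any `S₀`). Case `θ` ramified at `v̄` (some `τ' ∈ I_v̄` with
`θ(τ') ≠ 1`): x1-p1-w4's `grSelmer_charModule_eq_unrSelmer_of_ramified` (no `(ker κ ⊓ I_v̄)`-fixed vector). Case `θ(I_v̄) = 1`: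
`ker κ ⊓ I_v̄` acts trivially; `θ(τ) ≠ 1` for `τ ∈ D_v̄` descends to some `q₀ ∈ D_v̄ ⊓ ker κ` (`p`-power descent
`exists_mem_inf_kerSubgroup_unitChar_ne_one`, `D_v̄` closed); `q₀` is central modulo `I_v̄` by `hDI` and `q₀ − 1` is bijective
(`bijective_smul_sub_of_unitChar_ne_one`); §2. CGLS, proof of Thm. 1.2.2: for `θ|_{G_v̄} ≠ 𝟙` «`H¹_{F_Gr}(K, M_θ)` is the same as the
one defined by the unramified local conditions». [cite: CastellaGrossiLeeSkinner2022, proof of Thm. 1.2.2, Prop. 1.1.2 (i) (arXiv:2008.02571 Thm. 11, Prop. 8)]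
[cite: KellerYin2024, Rem. 1.2.3 and Lemma 1.2.4 (arXiv:2402.12781v2 TeX L685–800)] -/
theorem grSelmer_charModule_eq_unrSelmer_of_decomp_ne_one
    (hθ : ∀ σ : absoluteGaloisGroup K, θ σ ^ (p - 1) = 1)
    (hDI : ∀ x ∈ decomp vbar, ∀ y ∈ decomp vbar, x⁻¹ * y⁻¹ * x * y ∈ inertia vbar)
    {τ : absoluteGaloisGroup K} (hτ : τ ∈ decomp vbar) (hne : unitChar θ τ ≠ 1) :
    grSelmer κ (charModule (∅ : Set (PadicAlgCl p)) θ) vbar S₀ =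
      unrSelmer κ (charModule (∅ : Set (PadicAlgCl p)) θ) vbar S₀ := by
  by_cases hram : ∃ τ' ∈ inertia vbar, unitChar θ τ' ≠ 1
  · obtain ⟨τ', hτ', hne'⟩ := hram
    exact grSelmer_charModule_eq_unrSelmer_of_ramified κ vbar S₀ θ hθ hτ' hne'
  · push Not at hram
    -- `ker κ ⊓ I_v̄` (indeed `I_v̄`) acts trivially
    have hIfix : ∀ g : absoluteGaloisGroup K, g ∈ κ.kerSubgroup → g ∈ inertia vbar →
        ∀ m : charModule (∅ : Set (PadicAlgCl p)) θ, g • m = m :=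
      fun g _ hgI m ↦ smul_charModule_eq_of_unitChar_eq_one θ (hram g hgI) m
    -- a non-trivially acting element of `D_v̄ ⊓ ker κ`
    obtain ⟨q₀, hq₀, hq₀ne⟩ := exists_mem_inf_kerSubgroup_unitChar_ne_one κ θ hθ (decomp vbar) (isClosed_decomp vbar) hτ hne
    obtain ⟨hq₀D, hq₀H⟩ := Subgroup.mem_inf.mp hq₀
    exact grSelmer_eq_unrSelmer_of_central κ vbar S₀ hIfix hq₀H
      (fun x _ hxD ↦ hDI x hxD q₀ hq₀D) (bijective_smul_sub_of_unitChar_ne_one θ hθ hq₀ne)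

/-- **The same, with the non-triviality of `θ` on `D_v̄` in the RESIDUAL form of CGLS §1.2's named facts** («`θ|_{G_v̄} ≠ 𝟙`»: `D_v̄` does not
fix `(F/𝒪)(θ)[p]` pointwise): `grSelmer κ (charModule ∅ θ) v̄ S₀ = unrSelmer κ (charModule ∅ θ) v̄ S₀`, granted `[D_v̄, D_v̄] ⊆ I_v̄`.
[cite: CastellaGrossiLeeSkinner2022, §1.2 (standing hypotheses on θ), proof of Thm. 1.2.2] -/
theorem grSelmer_charModule_eq_unrSelmer_of_not_forall_decomp
    (hθ : ∀ σ : absoluteGaloisGroup K, θ σ ^ (p - 1) = 1)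
    (hDI : ∀ x ∈ decomp vbar, ∀ y ∈ decomp vbar, x⁻¹ * y⁻¹ * x * y ∈ inertia vbar)
    (hne1 : ¬ ∀ g ∈ decomp vbar, ∀ m : charModule (∅ : Set (PadicAlgCl p)) θ, p • m = 0 → g • m = m) :
    grSelmer κ (charModule (∅ : Set (PadicAlgCl p)) θ) vbar S₀ =
      unrSelmer κ (charModule (∅ : Set (PadicAlgCl p)) θ) vbar S₀ := by
  push Not at hne1
  obtain ⟨τ, hτ, m, -, hm⟩ := hne1
  have hne : unitChar θ τ ≠ 1 := fun h ↦ hm (smul_charModule_eq_of_unitChar_eq_one θ h m)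
  exact grSelmer_charModule_eq_unrSelmer_of_decomp_ne_one κ vbar S₀ θ hθ hDI hτ hne

end Character

end Summit.BirchSwinnertonDyer.BirchSwinnertonDyer.Theorems.StrictEqUnramifiedCentral

end
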